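import Summits.KontsevichZagierPeriods.KontsevichZagierPeriods.Theorems.LinRedNormalFormArrangementNormalFormSeparateThreeHIDirections

/-!
# Contact directions at a rim vertex on the pole plane are thick

(Line `janus-bands`, crux `ArrangementNormalForm`, stub `stub_separateThreeZero`, part `HIContact`
of the termwise numerator split `separateThree_hI` under the rim condition.)

A CONTACT direction `d` at a rim point `(v₀, 0)` of the closed cell on the pole plane is one along
which the closed local cone touches the pole plane: `hlo d = hhi d = 0`. Polyhedrality excludes
thin fibres there: the bottom and top constraints of height `0` at `d` all have heights
proportional to the single transversal coordinate `bco d x` of the direction `x` (`hgt_eq_bco_mul`,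
two-dimensionality of the base), the other constraints do not compete near `d`, so on either side of
`d` the ratio bottom height / top height of a non-empty cone fibre is a CONSTANT `< 1`
(`dir_contact`, registered as `separateThree_contact`): near a contact direction the fibres are
thick and the one-dimensional brick applies.
-/

noncomputable section

open Set Filter Topology

namespace Summit.KontsevichZagierPeriods.ArrangementNormalForm.JanusBands

namespace SepThree

/-! ### The transversal coordinate of a direction -/

/-- The transversal coordinate of `x` relative to the direction `d`: the coefficient of
`d⊥ = (-d 1, d 0)` in the decomposition `x = a d + b d⊥`. -/
def bco (d x : Fin 2 → ℝ) : ℝ := (d 0 * x 1 - d 1 * x 0) / (d 0 ^ 2 + d 1 ^ 2)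

/-- The perpendicular direction. -/
def dperp (d : Fin 2 → ℝ) : Fin 2 → ℝ := ![-d 1, d 0]

/-- The transversal coordinate is continuous. -/
theorem continuous_bco (d : Fin 2 → ℝ) : Continuous (bco d) := by unfold bco; fun_prop

/-- The transversal coordinate of the direction itself vanishes. -/
theorem bco_self (d : Fin 2 → ℝ) : bco d d = 0 := by simp [bco, mul_comm]

/-- A non-zero vector of `Fin 2 → ℝ` has positive Euclidean square norm. -/
theorem sq_add_sq_pos {d : Fin 2 → ℝ} (hd : d ≠ 0) : 0 < d 0 ^ 2 + d 1 ^ 2 := by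
  by_contra h
  push Not at h
  have h0 : d 0 = 0 := by nlinarith [sq_nonneg (d 0), sq_nonneg (d 1)]
  have h1 : d 1 = 0 := by nlinarith [sq_nonneg (d 0), sq_nonneg (d 1)]
  exact hd (funext fun i => by fin_cases i <;> assumption)

/-- **A height vanishing at `d` is proportional to the transversal coordinate.** -/
theorem hgt_eq_bco_mul (t : Con) {d : Fin 2 → ℝ} (hd : d ≠ 0) (h0 : hgt t d = 0) (x : Fin 2 → ℝ) :
    hgt t x = bco d x * hgt t (dperp d) := by
  have hD := sq_add_sq_pos hd
  by_cases hc : t.2.1 = 0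
  · simp [hgt, hc]
  · have hlin : t.1 0 * d 0 + t.1 1 * d 1 = 0 := by
      have := h0
      rw [hgt, blin, div_eq_zero_iff] at this
      rcases this with h | h
      · linarith
      · exact absurd h hc
    simp only [hgt, blin, bco, dperp, Matrix.cons_val_zero, Matrix.cons_val_one]
    field_simp
    linear_combination (-(d 0 * x 0 + d 1 * x 1)) * hlin

/-! ### Contact directions -/

section Contact

variable {J : ℕ} (g : Fin J → Con) (v₀ : Fin 2 → ℝ)
  (hB : (bots g v₀).Nonempty) (hT : (tops g v₀).Nonempty)

/-- The bottom constraints of height `0` at `d`. -/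
def bots0 (d : Fin 2 → ℝ) : Finset (Fin J) := (bots g v₀).filter fun j => hgt (g j) d = 0

/-- The top constraints of height `0` at `d`. -/
def tops0 (d : Fin 2 → ℝ) : Finset (Fin J) := (tops g v₀).filter fun j => hgt (g j) d = 0

/-- Membership in `bots0`. -/
theorem mem_bots0 {d : Fin 2 → ℝ} {j : Fin J} : j ∈ bots0 g v₀ d ↔ j ∈ bots g v₀ ∧ hgt (g j) d = 0 := by
  simp [bots0]

/-- Membership in `tops0`. -/
theorem mem_tops0 {d : Fin 2 → ℝ} {j : Fin J} : j ∈ tops0 g v₀ d ↔ j ∈ tops g v₀ ∧ hgt (g j) d = 0 := by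
  simp [tops0]

include hB hT in
/-- **Contact directions are thick.** If `hlo d = hhi d = 0`, there is `θ < 1` such that the
non-empty cone fibres over displacements with direction near `d` are intervals `(lo, hi)` with
`0 ≤ lo ≤ θ hi`. -/
theorem dir_contact (hcl : ((v₀, 0) : (Fin 2 → ℝ) × ℝ) ∈ closure (Om3 g))
    (hup : ∀ p ∈ closure (Om3 g), 0 ≤ p.2) {d : Fin 2 → ℝ} (hd : d ≠ 0)
    (h1 : hlo g v₀ hB d = 0) (h2 : hhi g v₀ hT d = 0) :
    ∃ ε > 0, ∃ θ : ℝ, 0 < θ ∧ θ < 1 ∧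
      ∀ u : Fin 2 → ℝ, u ≠ 0 → ‖udir u - d‖ < ε → (Kfib g v₀ u).Nonempty →
        Kfib g v₀ u = Ioo (hlo g v₀ hB u) (hhi g v₀ hT u) ∧ 0 ≤ hlo g v₀ hB u ∧
          hlo g v₀ hB u ≤ θ * hhi g v₀ hT u := by
  -- the constraints of height `0` at `d`
  have hB0 : (bots0 g v₀ d).Nonempty := by
    obtain ⟨j, hj, heq⟩ := Finset.exists_mem_eq_sup' hB fun j => hgt (g j) d
    exact ⟨j, (mem_bots0 g v₀).2 ⟨hj, by rw [← heq]; exact h1⟩⟩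
  have hT0 : (tops0 g v₀ d).Nonempty := by
    obtain ⟨j, hj, heq⟩ := Finset.exists_mem_eq_inf' hT fun j => hgt (g j) d
    exact ⟨j, (mem_tops0 g v₀).2 ⟨hj, by rw [← heq]; exact h2⟩⟩
  set p : Fin J → ℝ := fun j => hgt (g j) (dperp d) with hp
  set maxp := (bots0 g v₀ d).sup' hB0 p with hmaxp
  set minp := (bots0 g v₀ d).inf' hB0 p with hminp
  set maxq := (tops0 g v₀ d).sup' hT0 p with hmaxq
  set minq := (tops0 g v₀ d).inf' hT0 p with hminq
  -- the thickness ratio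
  set ρp : ℝ := if maxp < minq ∧ 0 ≤ maxp then maxp / minq else 0 with hρp
  set ρm : ℝ := if maxq < minp ∧ minp ≤ 0 then minp / maxq else 0 with hρm
  have hρp0 : 0 ≤ ρp := by
    simp only [hρp]; split_ifs with h
    · exact div_nonneg h.2 (h.2.trans h.1.le)
    · exact le_rfl
  have hρp1 : ρp < 1 := by
    simp only [hρp]; split_ifs with h
    · exact (div_lt_one (h.2.trans_lt h.1)).2 h.1
    · exact zero_lt_one
  have hρm0 : 0 ≤ ρm := by
    simp only [hρm]; split_ifs with h
    · exact div_nonneg_of_nonpos h.2 (h.1.le.trans h.2)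
    · exact le_rfl
  have hρm1 : ρm < 1 := by
    simp only [hρm]; split_ifs with h
    · have hq : maxq < 0 := h.1.trans_le h.2
      rw [div_lt_one_of_neg hq]
      exact h.1
    · exact zero_lt_one
  set θ := max (1 / 2) (max ρp ρm) with hθ
  have hθ0 : 0 < θ := lt_max_of_lt_left one_half_pos
  have hθ1 : θ < 1 := max_lt one_half_lt_one (max_lt hρp1 hρm1)
  -- the margin of the competing constraints
  have hbot_neg : ∀ j ∈ bots g v₀, j ∉ bots0 g v₀ d → hgt (g j) d < 0 := fun j hj hj0 => by
    have hle : hgt (g j) d ≤ hlo g v₀ hB d := Finset.le_sup' (fun j => hgt (g j) d) hj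
    rw [h1] at hle
    exact hle.lt_of_ne fun h => hj0 ((mem_bots0 g v₀).2 ⟨hj, h⟩)
  have htop_pos : ∀ j ∈ tops g v₀, j ∉ tops0 g v₀ d → 0 < hgt (g j) d := fun j hj hj0 => by
    have hle : hhi g v₀ hT d ≤ hgt (g j) d := Finset.inf'_le (fun j => hgt (g j) d) hj
    rw [h2] at hle
    exact hle.lt_of_ne fun h => hj0 ((mem_tops0 g v₀).2 ⟨hj, h.symm⟩)
  -- tolerance of constraint `j`
  set τ : Fin J → ℝ := fun j => if hgt (g j) d = 0 then 1 else |hgt (g j) d| / 2 with hτ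
  have hτ0 : ∀ j, 0 < τ j := fun j => by
    simp only [hτ]; split_ifs with h
    · exact one_pos
    · exact half_pos (abs_pos.2 h)
  obtain ⟨m, hm0, hm⟩ := exists_pos_le_all τ hτ0
  -- the neighbourhood: every height within its tolerance, and the transversal coordinate small
  set Pbd : ℝ := (bots g v₀ ∪ tops g v₀).sup' (hB.mono Finset.subset_union_left) fun j => |p j| with hPbd
  have hPbd0 : 0 ≤ Pbd := by
    obtain ⟨j, hj⟩ := hB
    exact (abs_nonneg (p j)).trans (Finset.le_sup' (fun j => |p j|) (Finset.mem_union_left _ hj))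
  have hev : ∀ᶠ x in 𝓝 d, (∀ j, |hgt (g j) x - hgt (g j) d| < m / 2) ∧ |bco d x| * (Pbd + 1) < m / 2 := by
    refine (eventually_all.2 fun j => ?_).and ?_
    · have hc : Continuous fun x => |hgt (g j) x - hgt (g j) d| :=
        ((continuous_hgt (g j)).sub continuous_const).abs
      have h0 : |hgt (g j) d - hgt (g j) d| = 0 := by simp
      exact (hc.tendsto d).eventually_lt_const (by rw [h0]; positivity)
    · have hc : Continuous fun x => |bco d x| * (Pbd + 1) := (continuous_bco d).abs.mul continuous_const
      refine (hc.tendsto d).eventually_lt_const ?_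
      rw [bco_self, abs_zero, zero_mul]; positivity
  obtain ⟨ε, hε, hball⟩ := Metric.eventually_nhds_iff.1 hev
  refine ⟨ε, hε, θ, hθ0, hθ1, fun u hu hud hne => ?_⟩
  have hv := vert_of_nonempty g v₀ hne
  refine ⟨Kfib_eq_Ioo g v₀ hB hT hv, hlo_nonneg g v₀ hB hT hcl hup hne, ?_⟩
  -- reduce to the direction `x`
  have hn : 0 < ‖u‖ := norm_pos_iff.2 hu
  have hlo0 : 0 ≤ hlo g v₀ hB (udir u) := by
    have := hlo_nonneg g v₀ hB hT hcl hup hne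
    rw [hlo_eq_dir g v₀ hB hu] at this
    exact (mul_nonneg_iff_of_pos_left hn).1 this
  have hlt : hlo g v₀ hB (udir u) < hhi g v₀ hT (udir u) := by
    have := hlo_lt_hhi_of_nonempty g v₀ hB hT hne
    rw [hlo_eq_dir g v₀ hB hu, hhi_eq_dir g v₀ hT hu] at this
    exact lt_of_mul_lt_mul_left this hn.le
  rw [hlo_eq_dir g v₀ hB hu, hhi_eq_dir g v₀ hT hu, mul_left_comm]
  refine mul_le_mul_of_nonneg_left ?_ hn.le
  set x := udir u with hx
  obtain ⟨hclose, hbsmall⟩ := hball (show dist x d < ε by rw [hx, dist_dir_eq]; exact hud)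
  -- the heights of the constraints of height `0` at `d` along `x`
  set s := bco d x with hs
  have hprop : ∀ j, hgt (g j) d = 0 → hgt (g j) x = s * p j := fun j hj =>
    hgt_eq_bco_mul (g j) hd hj x
  have hsp : ∀ j ∈ bots g v₀ ∪ tops g v₀, |s * p j| < m / 2 := fun j hj => by
    have hle : |p j| ≤ Pbd := Finset.le_sup' (fun j => |p j|) hj
    calc |s * p j| = |s| * |p j| := abs_mul _ _
      _ ≤ |s| * (Pbd + 1) := mul_le_mul_of_nonneg_left (by linarith) (abs_nonneg _)
      _ < m / 2 := hbsmall
  -- `hlo x` is attained at a constraint of height `0` at `d`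
  obtain ⟨jb, hjb, hjbeq⟩ := Finset.exists_mem_eq_sup' hB fun j => hgt (g j) x
  have hjb0 : jb ∈ bots0 g v₀ d := by
    by_contra hnot
    have hneg := hbot_neg jb hjb hnot
    have hcl' := hclose jb
    have hτj : m ≤ |hgt (g jb) d| / 2 := by
      have := hm jb; simp only [hτ, if_neg hneg.ne] at this; exact this
    have : hgt (g jb) x < 0 := by
      rw [abs_lt] at hcl'
      rw [abs_of_neg hneg] at hτj
      linarith
    have hlo_eq : hlo g v₀ hB x = hgt (g jb) x := hjbeq
    linarith
  obtain ⟨kt, hkt, hkteq⟩ := Finset.exists_mem_eq_inf' hT fun j => hgt (g j) x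
  have hkt0 : kt ∈ tops0 g v₀ d := by
    by_contra hnot
    have hpos := htop_pos kt hkt hnot
    have hcl' := hclose kt
    have hτk : m ≤ |hgt (g kt) d| / 2 := by
      have := hm kt; simp only [hτ, if_neg hpos.ne'] at this; exact this
    have hbig : m / 2 < hgt (g kt) x := by
      rw [abs_lt] at hcl'
      rw [abs_of_pos hpos] at hτk
      linarith
    -- but `hhi x ≤ hgt k₀ x = s p k₀` is small for any `k₀ ∈ tops0`
    obtain ⟨k₀, hk₀⟩ := hT0
    obtain ⟨hk₀t, hk₀0⟩ := (mem_tops0 g v₀).1 hk₀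
    have hle : hhi g v₀ hT x ≤ hgt (g k₀) x := Finset.inf'_le (fun j => hgt (g j) x) hk₀t
    rw [hprop k₀ hk₀0] at hle
    have hsmall := hsp k₀ (Finset.mem_union_right _ hk₀t)
    rw [abs_lt] at hsmall
    have hhi_eq : hhi g v₀ hT x = hgt (g kt) x := hkteq
    linarith
  obtain ⟨hjbb, hjbz⟩ := (mem_bots0 g v₀).1 hjb0
  obtain ⟨hktt, hktz⟩ := (mem_tops0 g v₀).1 hkt0
  have hlo_eq : hlo g v₀ hB x = s * p jb := by rw [show hlo g v₀ hB x = _ from hjbeq, hprop jb hjbz]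
  have hhi_eq : hhi g v₀ hT x = s * p kt := by rw [show hhi g v₀ hT x = _ from hkteq, hprop kt hktz]
  -- every constraint of height `0` at `d` bounds `hlo x`, `hhi x`
  have hlo_ge : ∀ j ∈ bots0 g v₀ d, s * p j ≤ s * p jb := fun j hj => by
    obtain ⟨hjb', hjz⟩ := (mem_bots0 g v₀).1 hj
    rw [← hlo_eq, ← hprop j hjz]
    exact Finset.le_sup' (fun j => hgt (g j) x) hjb'
  have hhi_le : ∀ j ∈ tops0 g v₀ d, s * p kt ≤ s * p j := fun j hj => by
    obtain ⟨hjt', hjz⟩ := (mem_tops0 g v₀).1 hj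
    rw [← hhi_eq, ← hprop j hjz]
    exact Finset.inf'_le (fun j => hgt (g j) x) hjt'
  rw [hlo_eq] at hlo0 hlt ⊢
  rw [hhi_eq] at hlt ⊢
  rcases lt_trichotomy s 0 with hsneg | hszero | hspos
  · -- `s < 0`: `p jb = minp`, `p kt = maxq`
    have hpjb : p jb = minp := by
      refine le_antisymm ((Finset.le_inf'_iff hB0 _).2 fun j hj => ?_) (Finset.inf'_le p hjb0)
      exact (mul_le_mul_left_of_neg hsneg).1 (hlo_ge j hj)
    have hpkt : p kt = maxq := by
      refine le_antisymm (Finset.le_sup' p hkt0) (Finset.sup'_le hT0 _ fun j hj => ?_)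
      exact (mul_le_mul_left_of_neg hsneg).1 (hhi_le j hj)
    have hcond : maxq < minp ∧ minp ≤ 0 := by
      rw [← hpjb, ← hpkt]
      refine ⟨(mul_lt_mul_left_of_neg hsneg).1 hlt, ?_⟩
      by_contra hcon
      push Not at hcon
      have := mul_neg_of_neg_of_pos hsneg hcon
      linarith
    have hρ : ρm = minp / maxq := by simp only [hρm, if_pos hcond]
    have hmaxq : maxq < 0 := hcond.1.trans_le hcond.2
    have hθρ : minp / maxq ≤ θ := by
      rw [← hρ]; exact (le_max_right _ _).trans (le_max_right _ _)
    have hsq : 0 < s * p kt := by nlinarith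
    have hmaxq0 : maxq ≠ 0 := hmaxq.ne
    calc s * p jb = (minp / maxq) * (s * p kt) := by
          rw [hpjb, hpkt]; field_simp
      _ ≤ θ * (s * p kt) := mul_le_mul_of_nonneg_right hθρ hsq.le
  · rw [hszero, zero_mul, zero_mul] at hlt
    exact absurd hlt (lt_irrefl 0)
  · -- `0 < s`: `p jb = maxp`, `p kt = minq`
    have hpjb : p jb = maxp := by
      refine le_antisymm (Finset.le_sup' p hjb0) (Finset.sup'_le hB0 _ fun j hj => ?_)
      exact le_of_mul_le_mul_left (hlo_ge j hj) hspos
    have hpkt : p kt = minq := by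
      refine le_antisymm ((Finset.le_inf'_iff hT0 _).2 fun j hj => ?_) (Finset.inf'_le p hkt0)
      exact le_of_mul_le_mul_left (hhi_le j hj) hspos
    have hcond : maxp < minq ∧ 0 ≤ maxp := by
      rw [← hpjb, ← hpkt]
      exact ⟨lt_of_mul_lt_mul_left hlt hspos.le, (mul_nonneg_iff_of_pos_left hspos).1 hlo0⟩
    have hρ : ρp = maxp / minq := by simp only [hρp, if_pos hcond]
    have hminq : 0 < minq := hcond.2.trans_lt hcond.1
    have hθρ : maxp / minq ≤ θ := by
      rw [← hρ]; exact (le_max_left _ _).trans (le_max_right _ _)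
    have hsq : 0 < s * p kt := by rw [hpkt]; exact mul_pos hspos hminq
    have hminq0 : minq ≠ 0 := hminq.ne'
    calc s * p jb = (maxp / minq) * (s * p kt) := by
          rw [hpjb, hpkt]; field_simp
      _ ≤ θ * (s * p kt) := mul_le_mul_of_nonneg_right hθρ hsq.le

end Contact

end SepThree

/-- **Contact directions are thick** (registered part of `stub_separateThreeZero`; literal form of
`SepThree.dir_contact`): at a rim point `(v₀, 0)` of the closed cell on the pole plane, with the
closed cell above the pole plane, if the closed local cone touches the pole plane along the
direction `d` (`hlo d = hhi d = 0`), then there is `θ < 1` such that every non-empty cone fibre over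
a displacement with direction near `d` is an interval `(lo, hi)` with `0 ≤ lo ≤ θ hi`. -/
theorem separateThree_contact {J : ℕ} (g : Fin J → (Fin 2 → ℝ) × ℝ × ℝ) (v₀ : Fin 2 → ℝ) (hB : (SepThree.bots g v₀).Nonempty) (hT : (SepThree.tops g v₀).Nonempty) (hcl : ((v₀, 0) : (Fin 2 → ℝ) × ℝ) ∈ closure (SepThree.Om3 g)) (hup : ∀ p ∈ closure (SepThree.Om3 g), 0 ≤ p.2) (d : Fin 2 → ℝ) (hd : d ≠ 0) (h1 : SepThree.hlo g v₀ hB d = 0) (h2 : SepThree.hhi g v₀ hT d = 0) : ∃ ε > 0, ∃ θ : ℝ, 0 < θ ∧ θ < 1 ∧ ∀ u : Fin 2 → ℝ, u ≠ 0 → ‖SepThree.udir u - d‖ < ε → (SepThree.Kfib g v₀ u).Nonempty → SepThree.Kfib g v₀ u = Set.Ioo (SepThree.hlo g v₀ hB u) (SepThree.hhi g v₀ hT u) ∧ 0 ≤ SepThree.hlo g v₀ hB u ∧ SepThree.hlo g v₀ hB u ≤ θ * SepThree.hhi g v₀ hT u := by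
  exact SepThree.dir_contact g v₀ hB hT hcl hup hd h1 h2

end Summit.KontsevichZagierPeriods.ArrangementNormalForm.JanusBands
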